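/-
Copyright (c) 2026. All rights reserved.
Released under Apache 2.0 license as described in the file LICENSE.
Authors: abc-iut cell, seat abc-iut-f-069 (gen 3; row «P13-ND-IFF»: faithfulness certificate for the non-degeneracy hypothesis).
-/
import Literature.AnabelianGeometry.AbsoluteAnabelian.AbsTopII.DPSCDataOfOuterActionInputL

/-!
# [AbsTopII] Prop 1.3 (iv)′.2 at `Π_𝒢 ⋊^out_θ J`: «non-degenerate Dehn type» ⟺ «(iv)′.2 ∧ (iv) at open subgroups»

S. Mochizuki, *Topics in Absolute Anabelian Geometry II* [AbsTopII] (bib `MochizukiAbsTopII2013`; kurims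
manuscript `paper:url-585b8d0ad0d9`), §1 Def 1.2 (ii) p. 10, Prop 1.3 (iv) p. 12 ("In particular,
`I_v ∩ I_{v′} ≠ {1}` implies that `v = v′`"), proof of (v) p. 16 ("if, for `γ ∈ Π_H`,
`I_v ∩ (γ·I_v·γ⁻¹) ≠ {1}`, then `Π_v = γ·Π_v·γ⁻¹`"); [CombGC] (bib `MochizukiCombGC2007`) Prop 1.2 (i),
Def 1.4 (i).

PROOF-ONLY (no definition).  FAITHFULNESS CERTIFICATE for the θ-level hypothesis «`ρ_I` is a NON-DEGENERATE
profinite Dehn multi-twist» of abc-iut-f-069's `inputL_ofOuterAction_of_nondegenerate` (p445938: for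
`i ∈ I`, `i ≠ 1`, a lift of `θ(i)` fixing pointwise `Π_v` and `γΠ_{v′}γ⁻¹` forces `γΠ_{v′}γ⁻¹ = Π_v`): at the
constructed DPSC-extension `Π_𝒢 ⋊^out_θ J` it is EQUIVALENT to the conjunction of the two PRINTED clauses
it replaces — abc-iut-L4-t4's typed "In particular" clause of (iv)′ (`I_v ∩ γI_{v′}γ⁻¹ ≠ {1} ⇒ v = v′`,
`γ ∈ Π_𝔾`) and row I-L ("(iv) at open subgroups") — given graphicity, `I_v ∩ Π_𝔾 = {1}` and [CombGC]
Prop 1.2 (i); so the hypothesis is the θ-form of print's statements, not stronger.  PROVED here: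
* `DPSCData.exists_mem_Iv_of_fixingLift` — a Π_v-fixing lift `φ` of `θ(i)` is the `Aut`-component of an
  element `h ∈ I_v` over `i` (`h := (φ, i) ∈ Aut(Π_𝒢) ×_{Out} J`);
* `DPSCData.conjAutOf_inlProfinite_apply` — the `Aut`-component of `inl g` is `conj g`;
* `DPSCData.nondegenerate_of_prop13iv'₂_of_inputL` — (iv)′.2 ∧ I-L ⇒ non-degeneracy;
* `DPSCData.prop13iv'₂_ofOuterAction_of_nondegenerate` — non-degeneracy ⇒ (iv)′.2 (with graphicity,
  `I_v ∩ Π_𝔾 = {1}`, [CombGC] Prop 1.2 (i));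
* `DPSCData.nondegenerate_iff` — the equivalence.
HONEST FRAMING: classical group theory; nothing here bears on [IUTchIII] Cor 3.12 or takes a side on any author.
-/

noncomputable section

open scoped Pointwise

namespace Literature.AnabelianGeometry.AbsoluteAnabelian

open Literature.AlgebraicGeometry.Frobenioids (IsSlimGroup)
open Literature.AnabelianGeometry.EtaleTheta (contMulAut mem_contMulAut TopOut innerContAut innerAut)
open Literature.AnabelianGeometry.SemiGraphs
open Topology

universe u

/-! ## §A. Generic transport (private twins of the AbsTopII transport lemmas) -/

section GroupTheory

variable {G : Type u} [Group G]

/-- `g·Z_G(K)·g⁻¹ = Z_G(g·K·g⁻¹)`. [folklore] -/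
private theorem conj_smul_centralizer₃ (g : G) (K : Subgroup G) :
    MulAut.conj g • Subgroup.centralizer (K : Set G) =
      Subgroup.centralizer ((MulAut.conj g • K : Subgroup G) : Set G) := by
  ext x
  rw [Subgroup.mem_pointwise_smul_iff_inv_smul_mem, Subgroup.mem_centralizer_iff,
    Subgroup.mem_centralizer_iff]
  constructor
  · intro h m hm
    rw [SetLike.mem_coe, Subgroup.mem_pointwise_smul_iff_inv_smul_mem] at hm
    have e := h _ hm
    rw [← smul_mul', ← smul_mul'] at e
    exact MulAction.injective _ e
  · intro h k hk
    have e := h (MulAut.conj g • k) (Subgroup.smul_mem_pointwise_smul _ _ _ hk)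
    apply MulAction.injective (MulAut.conj g)
    simp only [smul_mul', smul_inv_smul]
    exact e

end GroupTheory

namespace DPSCData

section OuterAction

variable {P : Type u} [Group P] [TopologicalSpace P] [IsTopologicalGroup P] [CompactSpace P]
  [TotallyDisconnectedSpace P] (G : PSCDatum P) (hG : IsTopologicallyFinitelyGenerated P)
  (hZ : Subgroup.center P = ⊥)
  {J : Type u} [Group J] [TopologicalSpace J] [IsTopologicalGroup J] [CompactSpace J]
  [TotallyDisconnectedSpace J] (θ : J →ₜ* outProfinite hG) (I : Subgroup J) [I.Normal]

omit [I.Normal] in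
/-- **A lift IS an `Aut`-component**: for `j ∈ J` and a bi-continuous lift `φ` of `θ(j)`, the pair `(φ, j)`
is an element `h` of `Π_𝒢 ⋊^out_θ J = Aut(Π_𝒢) ×_{Out(Π_𝒢)} J` with `snd h = j` and `conjAutOf h = φ`.
[cite: MochizukiSemiAnbd2006, §0 p.5] -/
theorem exists_of_lift (j : J) (φ : P ≃ₜ* P)
    (hφ : TopOut.mk P ⟨φ.toMulEquiv, (mem_contMulAut P).mpr ⟨φ.continuous, φ.symm.continuous⟩⟩ =
      outerActionOfContinuous hG θ j) :
    ∃ h : outerSemidirectProfinite hG θ, sndProfinite hG θ h = j ∧ ∀ x, conjAutOf hG θ h x = φ x := by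
  set c : contMulAut P := ⟨φ.toMulEquiv, (mem_contMulAut P).mpr ⟨φ.continuous, φ.symm.continuous⟩⟩ with hc
  refine ⟨⟨(profiniteAutEquiv (hG := hG) c, j), by
      rw [mem_outerSemidirectSubgroup_iff]
      change outProj hG (profiniteAutEquiv (hG := hG) c) = θ j
      rw [← outEquiv_mk, hφ, outEquiv_outerActionOfContinuous]⟩, rfl, fun x => ?_⟩
  rw [conjAutOf_apply]
  unfold autComponent
  rw [show (⟨(profiniteAutEquiv (hG := hG) c, j), _⟩ : outerSemidirectProfinite hG θ).1.1 =
      profiniteAutEquiv (hG := hG) c from rfl, MulEquiv.symm_apply_apply]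
  rfl

omit [I.Normal] in
include hZ in
/-- **The `Aut`-component of `inl g` is conjugation by `g`** (`inl g = (conj g, 1)`; read off through
`h · inl x · h⁻¹ = inl (conjAutOf h x)` and injectivity of `inl`, `Π_𝒢` centre-free).
[cite: MochizukiSemiAnbd2006, §0 p.5] -/
theorem conjAutOf_inlProfinite_apply (g x : P) :
    conjAutOf hG θ (inlProfinite hG θ g) x = g * x * g⁻¹ := by
  apply inlProfinite_injective hG θ hZ
  rw [inlProfinite_conjAutOf, map_mul, map_mul, map_inv]

omit [I.Normal] in
include hZ in
/-- `conj (inl g) • inl(K) = inl(g·K·g⁻¹)`. [cite: MochizukiSemiAnbd2006, §0 p.5] -/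
theorem conj_inl_smul_map_inl_eq (g : P) (K : Subgroup P) :
    MulAut.conj (inlProfinite hG θ g) • (K.map (inlProfinite hG θ).toMonoidHom :
        Subgroup (outerSemidirectProfinite hG θ)) =
      ((ConjAct.toConjAct g • K).map (inlProfinite hG θ).toMonoidHom : Subgroup (outerSemidirectProfinite hG θ)) := by
  rw [conj_smul_map_inl_eq]
  congr 1
  ext y
  constructor
  · rintro ⟨x, hx, rfl⟩
    refine (Subgroup.mem_smul_pointwise_iff_exists _ _ _).mpr ⟨x, hx, ?_⟩
    show ConjAct.toConjAct g • x = conjAutOf hG θ (inlProfinite hG θ g) x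
    rw [ConjAct.toConjAct_smul, conjAutOf_inlProfinite_apply hG hZ θ]
  · intro hy
    obtain ⟨x, hx, rfl⟩ := (Subgroup.mem_smul_pointwise_iff_exists _ _ _).mp hy
    refine ⟨x, hx, ?_⟩
    show conjAutOf hG θ (inlProfinite hG θ g) x = ConjAct.toConjAct g • x
    rw [ConjAct.toConjAct_smul, conjAutOf_inlProfinite_apply hG hZ θ]

include hZ in
/-- **A Π_v-fixing lift of `θ(i)`, `i ∈ I`, is the `Aut`-component of an element of `I_v` over `i`**, and if it
also fixes `γΠ_{v′}γ⁻¹` pointwise, that element lies in `inl(γ)·I_{v′}·inl(γ)⁻¹` as well.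
[cite: MochizukiAbsTopII2013, Prop 1.3 (iii) proof p.13] -/
theorem exists_mem_Iv_of_fixingLift {i : J} (hi : i ∈ I) {v v' : G.graph.V} {γ : P} {φ : P ≃ₜ* P}
    (hφ : TopOut.mk P ⟨φ.toMulEquiv, (mem_contMulAut P).mpr ⟨φ.continuous, φ.symm.continuous⟩⟩ =
      outerActionOfContinuous hG θ i)
    (hfix : ∀ x ∈ G.vertGp v, φ x = x) (hfix' : ∀ x ∈ ConjAct.toConjAct γ • G.vertGp v', φ x = x) :
    ∃ h : (ofOuterAction G hG θ I).PiH,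
      h ∈ (ofOuterAction G hG θ I).Iv ⟨v⟩ ∧
        h ∈ MulAut.conj (G := (ofOuterAction G hG θ I).PiH) ((inlProfinite hG θ).toMonoidHom γ) •
          (ofOuterAction G hG θ I).Iv ⟨v'⟩ ∧
        sndProfinite hG θ h = i := by
  haveI : (ofOuterAction G hG θ I).PiI.Normal := (ofOuterAction G hG θ I).normal_PiI
  obtain ⟨h₀, hsnd, hconj⟩ := exists_of_lift hG θ i φ hφ
  -- view `h₀` in the `Π_H` of the constructed datum (same type up to unfolding)
  obtain ⟨h, rfl⟩ : ∃ h : (ofOuterAction G hG θ I).PiH, h = h₀ := ⟨h₀, rfl⟩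
  -- `h` centralises `inl(K)` for every `K` fixed pointwise by `φ`
  have hcent : ∀ K : Subgroup P, (∀ x ∈ K, φ x = x) →
      h ∈ Subgroup.centralizer (((K.map (inlProfinite hG θ).toMonoidHom :
        Subgroup (ofOuterAction G hG θ I).PiH)) : Set (ofOuterAction G hG θ I).PiH) := by
    intro K hK
    let ι' : P →* (ofOuterAction G hG θ I).PiH := (inlProfinite hG θ).toMonoidHom
    refine Subgroup.mem_centralizer_iff.mpr (fun m hm => ?_)
    obtain ⟨x, hx, rfl⟩ := Subgroup.mem_map.mp hm
    show ι' x * h = h * ι' x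
    have e : h * ι' x * h⁻¹ = ι' x := by
      have e0 := inlProfinite_conjAutOf hG θ h x
      rw [hconj x, hK x hx] at e0
      exact e0.symm
    calc ι' x * h = h * ι' x * h⁻¹ * h := by rw [e]
      _ = h * ι' x := by rw [inv_mul_cancel_right]
  have hPiI : h ∈ (ofOuterAction G hG θ I).PiI := by
    show sndProfinite hG θ h ∈ I
    rw [hsnd]; exact hi
  refine ⟨h, Subgroup.mem_inf.mpr ⟨hcent _ hfix, hPiI⟩, ?_, hsnd⟩
  -- membership in `inl(γ)·I_{v′}·inl(γ)⁻¹ = Z(inl(γΠ_{v′}γ⁻¹)) ∩ Π_I`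
  show h ∈ MulAut.conj (G := (ofOuterAction G hG θ I).PiH) ((inlProfinite hG θ).toMonoidHom γ) •
    (Subgroup.centralizer ((((G.vertGp v').map (inlProfinite hG θ).toMonoidHom :
      Subgroup (ofOuterAction G hG θ I).PiH)) : Set (ofOuterAction G hG θ I).PiH) ⊓ (ofOuterAction G hG θ I).PiI)
  rw [Subgroup.smul_inf, Subgroup.Normal.conj_smul_eq_self _ (ofOuterAction G hG θ I).PiI,
    conj_smul_centralizer₃]
  refine Subgroup.mem_inf.mpr ⟨?_, hPiI⟩
  have e : MulAut.conj (G := (ofOuterAction G hG θ I).PiH) ((inlProfinite hG θ).toMonoidHom γ) •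
      (((G.vertGp v').map (inlProfinite hG θ).toMonoidHom : Subgroup (ofOuterAction G hG θ I).PiH)) =
        ((ConjAct.toConjAct γ • G.vertGp v').map (inlProfinite hG θ).toMonoidHom :
          Subgroup (ofOuterAction G hG θ I).PiH) :=
    conj_inl_smul_map_inl_eq hG hZ θ γ (G.vertGp v')
  rw [e]
  exact hcent _ hfix'

include hZ in
/-- **(iv)′.2 ∧ I-L ⇒ non-degeneracy**: if the typed "In particular" clause of Prop 1.3 (iv)′ ("`I_v ∩ γI_{v′}γ⁻¹
≠ {1}` implies `v = v′`", `γ ∈ Π_𝔾`) and row I-L ("`I_v ∩ gI_vg⁻¹ ≠ {1}` implies `gΠ_vg⁻¹ = Π_v`") hold at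
`Π_𝒢 ⋊^out_θ J`, then `ρ_I` is of non-degenerate Dehn type — the converse of
`inputL_ofOuterAction_of_nondegenerate` / `prop13iv'₂_ofOuterAction_of_nondegenerate`.
[cite: MochizukiAbsTopII2013, Prop 1.3 (iv) p.12] -/
theorem nondegenerate_of_prop13iv'₂_of_inputL
    (hiv2 : ∀ (v v' : (ofOuterAction G hG θ I).Vert) (γ : (ofOuterAction G hG θ I).PiH),
      γ ∈ (ofOuterAction G hG θ I).PiG →
        (ofOuterAction G hG θ I).Iv v ⊓ MulAut.conj γ • (ofOuterAction G hG θ I).Iv v' ≠ ⊥ → v = v')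
    (hL : ∀ (v : (ofOuterAction G hG θ I).Vert) (g : (ofOuterAction G hG θ I).PiH),
      (ofOuterAction G hG θ I).Iv v ⊓ MulAut.conj g • (ofOuterAction G hG θ I).Iv v ≠ ⊥ →
        MulAut.conj g • (ofOuterAction G hG θ I).vertSub v = (ofOuterAction G hG θ I).vertSub v) :
    ∀ i ∈ I, i ≠ 1 → ∀ (v v' : G.graph.V) (γ : ConjAct P),
      (∃ φ : P ≃ₜ* P,
        TopOut.mk P ⟨φ.toMulEquiv, (mem_contMulAut P).mpr ⟨φ.continuous, φ.symm.continuous⟩⟩ =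
          outerActionOfContinuous hG θ i ∧ (∀ x ∈ G.vertGp v, φ x = x) ∧ ∀ x ∈ γ • G.vertGp v', φ x = x) →
      γ • G.vertGp v' = G.vertGp v := by
  rintro i hi hne v v' γ ⟨φ, hφ, hfix, hfix'⟩
  set g : P := ConjAct.ofConjAct γ with hg
  have hγ : γ = ConjAct.toConjAct g := (ConjAct.toConjAct_ofConjAct γ).symm
  rw [hγ] at hfix' ⊢
  obtain ⟨h, hIv, hγIv, hsnd⟩ := exists_mem_Iv_of_fixingLift G hG hZ θ I hi hφ hfix hfix'
  have hmemG : (inlProfinite hG θ).toMonoidHom g ∈ (ofOuterAction G hG θ I).PiG := ⟨g, rfl⟩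
  have hne1 : h ≠ 1 := by
    intro h1
    apply hne
    rw [← hsnd, h1]
    exact map_one (sndProfinite hG θ)
  have hnb : (ofOuterAction G hG θ I).Iv ⟨v⟩ ⊓
      MulAut.conj (G := (ofOuterAction G hG θ I).PiH) ((inlProfinite hG θ).toMonoidHom g) •
        (ofOuterAction G hG θ I).Iv ⟨v'⟩ ≠ ⊥ := by
    intro hbot
    have hm : h ∈ (ofOuterAction G hG θ I).Iv ⟨v⟩ ⊓
        MulAut.conj (G := (ofOuterAction G hG θ I).PiH) ((inlProfinite hG θ).toMonoidHom g) •
          (ofOuterAction G hG θ I).Iv ⟨v'⟩ := ⟨hIv, hγIv⟩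
    rw [hbot] at hm
    exact hne1 (Subgroup.mem_bot.mp hm)
  -- (iv)′.2: `v = v′`
  have hvv : v = v' := congrArg ULift.down (hiv2 ⟨v⟩ ⟨v'⟩ _ hmemG hnb)
  subst hvv
  -- I-L: `inl(g)Π_v inl(g)⁻¹ = Π_v`, i.e. `inl(gΠ_vg⁻¹) = inl(Π_v)`
  have hfixed := hL ⟨v⟩ _ hnb
  have e : ((ConjAct.toConjAct g • G.vertGp v).map (inlProfinite hG θ).toMonoidHom :
      Subgroup (outerSemidirectProfinite hG θ)) = (G.vertGp v).map (inlProfinite hG θ).toMonoidHom := by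
    rw [← conj_inl_smul_map_inl_eq hG hZ θ g (G.vertGp v)]
    exact hfixed
  exact Subgroup.map_injective (inlProfinite_injective hG θ hZ) e

include hZ in
/-- **Non-degeneracy ⇒ (iv)′.2** at `Π_𝒢 ⋊^out_θ J`: the typed "In particular" clause of Prop 1.3 (iv)′
("`I_v ∩ γI_{v′}γ⁻¹ ≠ {1}` implies `v = v′`", `γ ∈ Π_𝔾`) from graphicity, `I_v ∩ Π_𝔾 = {1}`, [CombGC]
Prop 1.2 (i) (finite-index form `hDetv`) and NON-DEGENERACY of `ρ_I`.
[cite: MochizukiAbsTopII2013, Prop 1.3 (iv) p.12] [cite: MochizukiCombGC2007, Prop 1.2(i) p.8] -/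
theorem prop13iv'₂_ofOuterAction_of_nondegenerate
    (h13 : ∀ v, (ofOuterAction G hG θ I).Iv v ⊓ (ofOuterAction G hG θ I).PiG = ⊥)
    (hDetv : ∀ (v v' : (ofOuterAction G hG θ I).Vert) (γ : (ofOuterAction G hG θ I).PiH),
      γ ∈ (ofOuterAction G hG θ I).PiG →
        (MulAut.conj γ • (ofOuterAction G hG θ I).vertSub v' ⊓ (ofOuterAction G hG θ I).vertSub v).relIndex
          ((ofOuterAction G hG θ I).vertSub v) ≠ 0 → v' = v)
    (hND : ∀ i ∈ I, i ≠ 1 → ∀ (v v' : G.graph.V) (γ : ConjAct P),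
      (∃ φ : P ≃ₜ* P,
        TopOut.mk P ⟨φ.toMulEquiv, (mem_contMulAut P).mpr ⟨φ.continuous, φ.symm.continuous⟩⟩ =
          outerActionOfContinuous hG θ i ∧ (∀ x ∈ G.vertGp v, φ x = x) ∧ ∀ x ∈ γ • G.vertGp v', φ x = x) →
      γ • G.vertGp v' = G.vertGp v) :
    ∀ (v v' : (ofOuterAction G hG θ I).Vert) (γ : (ofOuterAction G hG θ I).PiH),
      γ ∈ (ofOuterAction G hG θ I).PiG →
        (ofOuterAction G hG θ I).Iv v ⊓ MulAut.conj γ • (ofOuterAction G hG θ I).Iv v' ≠ ⊥ → v = v' := by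
  intro v v' γ hγ hne
  obtain ⟨g, rfl⟩ : ∃ g : P, (inlProfinite hG θ).toMonoidHom g = γ := hγ
  obtain ⟨h, hh, hne1⟩ := ((ofOuterAction G hG θ I).Iv v ⊓
    MulAut.conj (G := (ofOuterAction G hG θ I).PiH) ((inlProfinite hG θ).toMonoidHom g) •
      (ofOuterAction G hG θ I).Iv v').bot_or_exists_ne_one.resolve_left hne
  obtain ⟨hIv, hgIv⟩ := Subgroup.mem_inf.mp hh
  have hi : sndProfinite hG θ h ≠ 1 := by
    intro h1
    have hG' : h ∈ (ofOuterAction G hG θ I).PiG := by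
      show h ∈ (inlProfinite hG θ).toMonoidHom.range
      rw [range_inlProfinite_eq_ker]
      exact h1
    have hbot : h ∈ (ofOuterAction G hG θ I).Iv v ⊓ (ofOuterAction G hG θ I).PiG := ⟨hIv, hG'⟩
    rw [h13 v, Subgroup.mem_bot] at hbot
    exact hne1 hbot
  have hiI : sndProfinite hG θ h ∈ I := (Subgroup.mem_inf.mp hIv).2
  have hfix₁ : ∀ x ∈ G.vertGp v.down, conjAutOf hG θ h x = x :=
    conjAutOf_apply_eq_self_of_mem_centralizer hG hZ θ (Subgroup.mem_inf.mp hIv).1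
  have hfix₂ : ∀ x ∈ ConjAct.toConjAct g • G.vertGp v'.down, conjAutOf hG θ h x = x := by
    apply conjAutOf_apply_eq_self_of_mem_centralizer hG hZ θ
    have hmem : h ∈ MulAut.conj (G := (ofOuterAction G hG θ I).PiH) ((inlProfinite hG θ).toMonoidHom g) •
        Subgroup.centralizer (((ofOuterAction G hG θ I).vertSub v' : Subgroup (ofOuterAction G hG θ I).PiH) :
          Set (ofOuterAction G hG θ I).PiH) := by
      rw [Subgroup.mem_pointwise_smul_iff_inv_smul_mem] at hgIv ⊢
      exact (Subgroup.mem_inf.mp hgIv).1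
    rw [conj_smul_centralizer₃] at hmem
    have e := conj_inl_smul_map_inl_eq hG hZ θ g (G.vertGp v'.down)
    have hmem' : h ∈ Subgroup.centralizer ((((ConjAct.toConjAct g • G.vertGp v'.down).map
        (inlProfinite hG θ).toMonoidHom : Subgroup (outerSemidirectProfinite hG θ))) :
          Set (outerSemidirectProfinite hG θ)) := by
      rw [← e]; exact hmem
    exact hmem'
  have hclass : TopOut.mk P ⟨(conjAutOf hG θ h).toMulEquiv, (mem_contMulAut P).mpr
      ⟨(conjAutOf hG θ h).continuous, (conjAutOf hG θ h).symm.continuous⟩⟩ =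
        outerActionOfContinuous hG θ (sndProfinite hG θ h) := by
    have : (⟨(conjAutOf hG θ h).toMulEquiv, (mem_contMulAut P).mpr
        ⟨(conjAutOf hG θ h).continuous, (conjAutOf hG θ h).symm.continuous⟩⟩ : contMulAut P) =
          autComponent hG θ h := Subtype.ext rfl
    rw [this, mk_autComponent]
    rfl
  have hγv : ConjAct.toConjAct g • G.vertGp v'.down = G.vertGp v.down :=
    hND _ hiI hi v.down v'.down _ ⟨conjAutOf hG θ h, hclass, hfix₁, hfix₂⟩
  -- [CombGC] Prop 1.2 (i): `inl(g)Π_{v′}inl(g)⁻¹ = Π_v` has finite index in `Π_v`, so `v′ = v`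
  refine (hDetv v v' _ ⟨g, rfl⟩ ?_).symm
  have e : MulAut.conj (G := (ofOuterAction G hG θ I).PiH) ((inlProfinite hG θ).toMonoidHom g) •
      (ofOuterAction G hG θ I).vertSub v' = (ofOuterAction G hG θ I).vertSub v := by
    have e0 := conj_inl_smul_map_inl_eq hG hZ θ g (G.vertGp v'.down)
    rw [hγv] at e0
    exact e0
  rw [e, inf_idem, Subgroup.relIndex_self]
  exact one_ne_zero

include hZ in
/-- **FAITHFULNESS CERTIFICATE: at `Π_𝒢 ⋊^out_θ J`, «`ρ_I` is a non-degenerate profinite Dehn multi-twist»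
⟺ «(iv)′.2 ∧ (iv) at open subgroups»**, given graphicity of the `Aut`-components, `I_v ∩ Π_𝔾 = {1}` and
[CombGC] Prop 1.2 (i) (finite-index form): the θ-level hypothesis of `inputL_ofOuterAction_of_nondegenerate`
is exactly the conjunction of print's "In particular" clause of Prop 1.3 (iv) and the p. 16 sentence of
the proof of (v), neither weaker nor stronger. [cite: MochizukiAbsTopII2013, Prop 1.3 (iv) p.12]
[cite: MochizukiAbsTopII2013, Prop 1.3 (v) proof p.16] -/
theorem nondegenerate_iff
    (hgraphic : ∀ h : outerSemidirectProfinite hG θ, G.IsGraphic G (conjAutOf hG θ h))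
    (h13 : ∀ v, (ofOuterAction G hG θ I).Iv v ⊓ (ofOuterAction G hG θ I).PiG = ⊥)
    (hDetv : ∀ (v v' : (ofOuterAction G hG θ I).Vert) (γ : (ofOuterAction G hG θ I).PiH),
      γ ∈ (ofOuterAction G hG θ I).PiG →
        (MulAut.conj γ • (ofOuterAction G hG θ I).vertSub v' ⊓ (ofOuterAction G hG θ I).vertSub v).relIndex
          ((ofOuterAction G hG θ I).vertSub v) ≠ 0 → v' = v) :
    (∀ i ∈ I, i ≠ 1 → ∀ (v v' : G.graph.V) (γ : ConjAct P),
      (∃ φ : P ≃ₜ* P,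
        TopOut.mk P ⟨φ.toMulEquiv, (mem_contMulAut P).mpr ⟨φ.continuous, φ.symm.continuous⟩⟩ =
          outerActionOfContinuous hG θ i ∧ (∀ x ∈ G.vertGp v, φ x = x) ∧ ∀ x ∈ γ • G.vertGp v', φ x = x) →
      γ • G.vertGp v' = G.vertGp v) ↔
    ((∀ (v v' : (ofOuterAction G hG θ I).Vert) (γ : (ofOuterAction G hG θ I).PiH),
        γ ∈ (ofOuterAction G hG θ I).PiG →
          (ofOuterAction G hG θ I).Iv v ⊓ MulAut.conj γ • (ofOuterAction G hG θ I).Iv v' ≠ ⊥ → v = v') ∧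
      ∀ (v : (ofOuterAction G hG θ I).Vert) (g : (ofOuterAction G hG θ I).PiH),
        (ofOuterAction G hG θ I).Iv v ⊓ MulAut.conj g • (ofOuterAction G hG θ I).Iv v ≠ ⊥ →
          MulAut.conj g • (ofOuterAction G hG θ I).vertSub v = (ofOuterAction G hG θ I).vertSub v) :=
  ⟨fun hND => ⟨prop13iv'₂_ofOuterAction_of_nondegenerate G hG hZ θ I h13 hDetv hND,
      inputL_ofOuterAction_of_nondegenerate G hG hZ θ I hgraphic h13 hND⟩,
    fun h => nondegenerate_of_prop13iv'₂_of_inputL G hG hZ θ I h.1 h.2⟩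

end OuterAction

end DPSCData

end Literature.AnabelianGeometry.AbsoluteAnabelian

end
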